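import Mathlib
import HarnessLib
import Summits.HubbardSuperconductivity.HubbardSuperconductivity.Theorems.KLProgrammeKLRegimeTwoVolumeStepMajorant
import Summits.HubbardSuperconductivity.HubbardSuperconductivity.Theorems.KLProgrammeKLRegimeTwoVolumeSubstitutionGluingDeepPin
import Summits.HubbardSuperconductivity.HubbardSuperconductivity.Theorems.KLProgrammeKLRegimeTwoVolumeGluedProfiles

/-!
# Route `KLProgramme` — crux K3, the nested two-volume pass: ONE SCALE OF THE INDUCTIVE COMPARISON (transfer through the re-sectorisations ∘ STEP)
# (cell gate-hubbard-kl, seat hubbard-kl-k3c4-p1 g9; VL-INDUCTION-BLUEPRINT-g8.md (vi) (1)+(2), memo VL-ROUTE-A-RADIUS-g9.md §3; `--supports` stmt-…-20440)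

Scale `j → j+1` of the two-volume tower, in one statement.  INPUT at scale `j`: the coarse and fine actions `𝒲`, `𝒲′` (labels `Γ₁`, `Γ₁′ ≃ ι × Γ₁`), the
deep defect profile `Ej` and the global defect profile `NDj` of `𝒲′ − Glue 𝒲` (induction hypothesis), one-volume profiles `Nj`, `Nfarj` of `𝒲`; the
re-sectorisation substitutions `Tc : Γ ← Γ₁`, `Tf : Γ′ ← Γ₁′` into the scale-`j+1` labels (`Γ′ ≃ ι × Γ`) with their masses `aT`, tails `τT`, block
periodisation `(P_T)`; one-volume weighted profiles `NV`, `NW′` of the re-sectorised actions; the scale-`j+1` covariance data of the STEP.  OUTPUT: the deep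
defect of `effAction C′ (map Tf 𝒲′) − Glue (effAction C (map Tc 𝒲))` at a pin `w` (far from the non-deep region and from the covariance zone) in the LINEAR
form of `…TwoVolumeStepMajorant` with the incoming defect norm `normV Γ′ κ′ ρ′ Ein`, `Ein` ANY majorant of the transfer bound
`aT^{2m−1}(aT·Ej(m) + τT·NDj(m)) + 2aT^{2m−1}τT·Nj(m) + (2m−1)aT^{2m−1}(5τT·Nj(m) + 2aT·Nfarj(m))` (`…SubstitutionGluingDeepPin` §2).

* **`twoVolume_scale_succ_le`**.  Everything proved; no definition.  Iterating it over `j ≤ n_β + 1` with the termwise limits of `…TwoVolumeDefectTannery`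
  is the (A3) induction of the VL stub `stub_vl_nestedFramed` (20440).

References: BGM 2006 §2–§3; Salmhofer 1999 §4.3, (2.102)–(2.106).
-/

noncomputable section

namespace Summit.HubbardSuperconductivity.HubbardSuperconductivity.Theorems.TwoVolumeDefect

set_option linter.dupNamespace false -- summit = problem name (single-conjunct summit), D-0017

open Finset Literature.MathematicalPhysics.QuantumLattice GrassmannAlgebra Literature.Probability.LatticeModels
  Literature.Probability.LatticeModels.BattleFederbush
open scoped Nat InnerProductSpace

variable {𝕜 : Type*} [RCLike 𝕜]

/-- **ONE SCALE OF THE INDUCTIVE TWO-VOLUME COMPARISON** (transfer of the scale-`j` defect through the re-sectorisations, then the STEP at scale `j+1`, in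
linear form).  See the module docstring for the roles of the data. [folklore; BGM 2006 §2–§3; Salmhofer 1999 (2.102)–(2.106)] -/
theorem twoVolume_scale_succ_le {Γ ι : Type*} [Fintype Γ] [DecidableEq Γ] [Fintype ι] [DecidableEq ι]
    {Γ' : Type} [LinearOrder Γ'] [Fintype Γ']
    {Γ₁ Γ₁' : Type*} [Fintype Γ₁] [DecidableEq Γ₁] [Fintype Γ₁'] [DecidableEq Γ₁'] (e₁ : Γ₁' ≃ ι × Γ₁)
    (Fe₁ : ι → (Γ₁ → 𝕜) →ₗ[𝕜] (Γ₁' → 𝕜)) (hFe₁ : ∀ β v X', Fe₁ β v X' = if (e₁ X').1 = β then v (e₁ X').2 else 0)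
    (e : Γ' ≃ ι × Γ) (C : Matrix Γ Γ 𝕜) (C' Ccop Dn Df : Matrix Γ' Γ' 𝕜) (Zs : Set Γ') [DecidablePred (· ∈ Zs)]
    (hCcop : ∀ X' Y', Ccop X' Y' = if (e X').1 = (e Y').1 then C (e X').2 (e Y').2 else 0)
    (hDf : ∀ X' Y', Df X' Y' = if X' ∈ Zs ∧ Y' ∈ Zs then C' X' Y' - Ccop X' Y' else 0)
    (hDn : ∀ X' Y', Dn X' Y' = if X' ∈ Zs ∧ Y' ∈ Zs then 0 else C' X' Y' - Ccop X' Y')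
    -- (P) periodisation, (G1)/(G2) geometry, row tail
    (hP : ∀ (X' : Γ') (Y : Γ), ∑ Y'' ∈ univ.filter (fun Y'' : Γ' => (e Y'').2 = Y), C' X' Y'' = C (e X').2 Y)
    (Far : Γ' → Γ' → Prop) [∀ X' Y', Decidable (Far X' Y')]
    (hG1 : ∀ X' Y', (e X').1 ≠ (e Y').1 → ¬ (X' ∈ Zs ∧ Y' ∈ Zs) → Far X' Y')
    (hG2 : ∀ X' Y' Y'', (e X').1 = (e Y').1 → (e Y'').2 = (e Y').2 → Y'' ≠ Y' → ¬ (X' ∈ Zs ∧ Y' ∈ Zs) → Far X' Y'')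
    {T : ℝ} (hT0 : 0 < T) (hT : ∀ X', ∑ Y' ∈ univ.filter (fun Y' : Γ' => Far X' Y'), ‖C' X' Y'‖ ≤ T)
    -- the ENTRY bound of the near defect (`norm_near_le_of_fibreTail` / `norm_near_le_of_sectional`)
    {Te : ℝ} (hTe : ∀ X' Y', ‖Dn X' Y'‖ ≤ Te)
    -- antisymmetry and decay numbers of `C`, `C′`
    (hCt : ∀ X Y, C Y X = -C X Y) (hC't : ∀ X' Y', C' Y' X' = -C' X' Y')
    {s s' : ℝ} (hs0 : 0 ≤ s) (hs'0 : 0 ≤ s') (hs : ∀ X Y, ‖C X Y‖ ≤ s) (hs' : ∀ X' Y', ‖C' X' Y'‖ ≤ s')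
    {α α' : ℝ} (hαα : 0 < α' + α) (hrow : ∀ X, ∑ Y, ‖C X Y‖ ≤ α) (hrow' : ∀ X', ∑ Y', ‖C' X' Y'‖ ≤ α')
    (dc : Γ → Γ → ℝ) (hdc : IsLabelDist dc) {m₁ m₁' : ℝ} (hm0 : 0 ≤ m₁) (hm0' : 0 ≤ m₁')
    (hm1 : ∀ X, ∑ Y, ‖C X Y‖ * dc X Y ≤ m₁) (hm1' : ∀ X', ∑ Y', ‖C' X' Y'‖ * dc (e X').2 (e Y').2 ≤ m₁')
    -- Gram PROPERTIES of the two defects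
    {κf : ℝ} (hκf : 0 < κf) (hGBf : ∀ t ∈ Set.Icc (0 : ℝ) 1, IsGramBoundedR (t • Df) κf)
    {κ₂ : ℝ} (hκ₂ : 0 < κ₂) (hGB2 : ∀ t ∈ Set.Icc (0 : ℝ) 1, IsGramBoundedR (Df + t • Dn) κ₂)
    -- the pin, far from the zone in the pulled-back coarse distance
    {Rf : ℝ} (hRf : 0 < Rf) (w : Γ') (hdR : ∀ X, X ∈ Zs → Rf ≤ dc (e X).2 (e w).2)
    -- the coarse interaction and the block embeddings
    (Fe : ι → (Γ → 𝕜) →ₗ[𝕜] (Γ' → 𝕜)) (hFe : ∀ β v X', Fe β v X' = if (e X').1 = β then v (e X').2 else 0)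
    -- the coarse scale-`j` action, its re-sectorisation `Tc`, the unit partition function of the coarse step
    (Tc : Matrix Γ Γ₁ 𝕜) (𝒲 : GrassmannAlgebra 𝕜 Γ₁) (h𝒲e : 𝒲 ∈ evenOdd 𝕜 0) (h𝒲0 : constPart 𝕜 𝒲 = 0)
    (hZ : IsUnit (effPartitionFn 𝕜 C (ExteriorAlgebra.map (Matrix.toLin' Tc) 𝒲)))
    -- the coarse diameter-weighted all-degree profile and the two smallness conditions
    (Nw : ℕ → ℝ) (hNw0 : ∀ m, 0 ≤ Nw m)
    (hNw : ∀ (m' : ℕ) (j : Fin (2 * m')) (x : Γ), ∑ Y ∈ univ.filter (fun Y : Fin (2 * m') → Γ => Y j = x),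
      ‖kernel 𝕜 (effAction 𝕜 C (ExteriorAlgebra.map (Matrix.toLin' Tc) 𝒲)) (2 * m') Y‖ * (1 + labelDiam dc (univ.image Y)) ≤ Nw m')
    {ρf : ℝ} (hρf : 0 < ρf) (hθw : Real.exp 1 * (α' + α + (m₁' + m₁)) * normV Γ' κf ρf Nw / κf ^ 2 < 1)
    {ρ₂ : ℝ} (hρ₂ : 0 < ρ₂) (hθ₂ : Real.exp 1 * (α' + α + (m₁' + m₁)) * normV Γ' κ₂ ρ₂ Nw / κ₂ ^ 2 < 1)
    -- the INTERACTION bracket: fine covariance Gram/weighted rows, the fine previous action `W′`, its defect against the glued `V`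
    {κ' : ℝ} (hκ' : 0 < κ') (hGB' : IsGramBoundedR C' κ')
    (d' : Γ' → Γ' → ℝ) (hd' : IsLabelDist d') {phi : ℝ → ℝ} (hphi1 : ∀ s, 0 ≤ s → 1 ≤ phi s) (hphimono : ∀ s t, 0 ≤ s → s ≤ t → phi s ≤ phi t)
    (hphisub : ∀ s t, 0 ≤ s → 0 ≤ t → phi (s + t) ≤ phi s * phi t)
    -- the fine scale-`j` action and its re-sectorisation `Tf`
    (Tf : Matrix Γ' Γ₁' 𝕜) (𝒲' : GrassmannAlgebra 𝕜 Γ₁') (h𝒲'e : 𝒲' ∈ evenOdd 𝕜 0) (h𝒲'0 : constPart 𝕜 𝒲' = 0)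
    -- ONE-volume weighted profiles at scale `j+1`: of the re-sectorised coarse action (coarse weight distance `dcw`, the restriction of `d′` to blocks)
    -- and of the re-sectorised fine action
    (dcw : Γ → Γ → ℝ) (hd'blk : ∀ (β : ι) (x y : Γ), d' (e.symm (β, x)) (e.symm (β, y)) = dcw x y)
    (NV NW' : ℕ → ℝ) (hNV0 : ∀ m', 0 ≤ NV m') (hNW'0 : ∀ m', 0 ≤ NW' m')
    (hNV : ∀ m' (j : Fin (2 * m')) (x : Γ), ∑ Y ∈ univ.filter (fun Y : Fin (2 * m') → Γ => Y j = x),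
      ‖kernel 𝕜 (ExteriorAlgebra.map (Matrix.toLin' Tc) 𝒲) (2 * m') Y‖ * diamWeight phi dcw (univ.image Y) ≤ NV m')
    (hNW' : ∀ m' (j : Fin (2 * m')) (x : Γ'), ∑ Y ∈ univ.filter (fun Y : Fin (2 * m') → Γ' => Y j = x),
      ‖kernel 𝕜 (ExteriorAlgebra.map (Matrix.toLin' Tf) 𝒲') (2 * m') Y‖ * diamWeight phi d' (univ.image Y) ≤ NW' m')
    -- the deep region at scale `j+1` and the TRANSFER data of the substitutions at its pins (regions relative to the pin)
    (Pd : Γ' → Prop) [DecidablePred Pd]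
    (Z Near : Γ' → Γ₁ → Prop) [∀ x, DecidablePred (Z x)] [∀ x, DecidablePred (Near x)] (Far₁ : Γ₁ → Γ₁ → Prop) [DecidableRel Far₁]
    (NearF : Γ' → Γ₁' → Prop) [∀ x, DecidablePred (NearF x)] {aT τT : ℝ} (haT : 0 ≤ aT) (hτT : 0 ≤ τT)
    (hPT : ∀ (X' : Γ') (Y : Γ₁), ∑ Y'' ∈ univ.filter (fun Y'' : Γ₁' => (e₁ Y'').2 = Y), Tf X' Y'' = Tc (e X').2 Y)
    (hcolT : ∀ y', ∑ x, ‖Tf x y'‖ ≤ aT)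
    (hwinT : ∀ β' y, ∑ β, ∑ x ∈ univ.filter (fun x : Γ' => (e x).1 = β'), ‖Tf x (e₁.symm (β, y))‖ ≤ aT)
    (hZT : ∀ x, Pd x → ∀ y y', Near x y → Z x y' → Far₁ y y')
    (hρT : ∀ x, Pd x → ∑ y, ‖Tf x (e₁.symm ((e x).1, y))‖ ≤ aT)
    (hrowFT : ∀ x, Pd x → ∑ y' ∈ univ.filter (fun y' : Γ₁' => NearF x y'), ‖Tf x y'‖ ≤ aT)
    (hτFT : ∀ x, Pd x → ∑ y' ∈ univ.filter (fun y' : Γ₁' => ¬ NearF x y'), ‖Tf x y'‖ ≤ τT)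
    (hτ₁T : ∀ x, Pd x → ∀ y, ¬ Z x y → ∑ x₂ ∈ univ.filter (fun x₂ : Γ' => (e x₂).1 ≠ (e x).1), ‖Tf x₂ (e₁.symm ((e x).1, y))‖ ≤ τT)
    (hτ₂T : ∀ x, Pd x → ∑ β ∈ univ.erase (e x).1, ∑ y, ‖Tf x (e₁.symm (β, y))‖ ≤ τT)
    (hτ₃T : ∀ x, Pd x → ∑ y ∈ univ.filter (fun y : Γ₁ => ¬ Near x y), ‖Tf x (e₁.symm ((e x).1, y))‖ ≤ τT)
    (hτ₄T : ∀ x, Pd x → ∀ y, ¬ Z x y → ∑ β ∈ univ.erase (e x).1, ∑ x₂ ∈ univ.filter (fun x₂ : Γ' => (e x₂).1 = (e x).1),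
      ‖Tf x₂ (e₁.symm (β, y))‖ ≤ τT)
    -- ONE-volume scale-`j` profiles of the coarse action (plain, far) and the scale-`j` two-volume data (induction hypothesis: deep `Ej`, everywhere `NDj`)
    -- (indexed by the RAW degree `k`)
    (Nj Nfarj Ej NDj : ℕ → ℝ) (hNj0 : ∀ k, 0 ≤ Nj k) (hNfarj0 : ∀ k, 0 ≤ Nfarj k) (hEj0 : ∀ k, 0 ≤ Ej k) (hNDj0 : ∀ k, 0 ≤ NDj k)
    (hNj : ∀ (k : ℕ) (p : Fin k) (y : Γ₁), ∑ Y ∈ univ.filter (fun Y : Fin k → Γ₁ => Y p = y), ‖kernel 𝕜 𝒲 k Y‖ ≤ Nj k)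
    (hNfarj : ∀ (k : ℕ) (p : Fin k) (y : Γ₁) (i : Fin k), ∑ Y ∈ univ.filter (fun Y : Fin k → Γ₁ => Y p = y ∧ Far₁ (Y p) (Y i)),
      ‖kernel 𝕜 𝒲 k Y‖ ≤ Nfarj k)
    (hEj : ∀ x, Pd x → ∀ (k : ℕ) (p : Fin k) (y' : Γ₁'), NearF x y' →
      ∑ Y' ∈ univ.filter (fun Y' : Fin k → Γ₁' => Y' p = y'), ‖kernel 𝕜 (𝒲' - ∑ β, ExteriorAlgebra.map (Fe₁ β) 𝒲) k Y'‖ ≤ Ej k)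
    (hNDj : ∀ (k : ℕ) (p : Fin k) (y' : Γ₁'),
      ∑ Y' ∈ univ.filter (fun Y' : Fin k → Γ₁' => Y' p = y'), ‖kernel 𝕜 (𝒲' - ∑ β, ExteriorAlgebra.map (Fe₁ β) 𝒲) k Y'‖ ≤ NDj k)
    -- the incoming deep defect profile at scale `j+1` (indexed by HALF the degree, as the STEP reads it): any majorant of the transfer bound
    (Ein : ℕ → ℝ) (hEin0 : ∀ m', 0 ≤ Ein m')
    (hEin : ∀ m', 1 ≤ m' → ∀ n : ℕ, 2 * m' = n + 1 → aT ^ n * (aT * Ej (n + 1) + τT * NDj (n + 1)) +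
      (2 * aT ^ n * τT * Nj (n + 1) + n * aT ^ n * (5 * τT * Nj (n + 1) + 2 * aT * Nfarj (n + 1))) ≤ Ein m')
    {αw : ℝ} (hαw : 0 < αw) (hroww : ∀ X', ∑ Y', ‖C' X' Y'‖ * diamWeight phi d' {X', Y'} ≤ αw)
    (hcolw : ∀ Y', ∑ X', ‖C' X' Y'‖ * diamWeight phi d' {X', Y'} ≤ αw) {ρ' : ℝ} (hρ' : 0 < ρ')
    {νEbar : ℝ} (hνE : normV Γ' κ' ρ' Ein ≤ νEbar)
    (hbar : Real.exp 1 * αw * (normV Γ' κ' ρ' (fun m' => NV m' + (NW' m' + NV m')) + νEbar) / κ' ^ 2 < 1)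
    (hθ₂' : Real.exp 1 * αw * (normV Γ' κ' ρ' NV + normV Γ' κ' ρ' (fun m' => NW' m' + NV m')) / κ' ^ 2 < 1)
    {Rd : ℝ} (hRd : 0 ≤ Rd) (hwd : ∀ z, ¬ Pd z → Rd ≤ d' z w)
    (n : ℕ) (p : Fin (n + 1)) :
    ∑ X ∈ univ.filter (fun X : Fin (n + 1) → Γ' => X p = w),
        ‖kernel 𝕜 (effAction 𝕜 C' (ExteriorAlgebra.map (Matrix.toLin' Tf) 𝒲')) (n + 1) X -
          kernel 𝕜 (∑ β, ExteriorAlgebra.map (Fe β) (effAction 𝕜 C (ExteriorAlgebra.map (Matrix.toLin' Tc) 𝒲))) (n + 1) X‖ ≤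
      (ρ'⁻¹ ^ (n + 1) * Real.exp 1 / (1 - Real.exp 1 * αw * (normV Γ' κ' ρ' (fun m' => NV m' + (NW' m' + NV m')) + νEbar) / κ' ^ 2) ^ 2) * normV Γ' κ' ρ' Ein +
        (ρ'⁻¹ ^ (n + 1) * (Real.exp 1 * normV Γ' κ' ρ' (fun m' => NW' m' + NV m')) / (1 - Real.exp 1 * αw * (normV Γ' κ' ρ' NV + normV Γ' κ' ρ' (fun m' => NW' m' + NV m')) / κ' ^ 2) ^ 2) * (phi Rd)⁻¹ +
        ((((n + 1 + 1) * (n + 1 + 2) : ℕ) : ℝ) / 2 *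
            (ρ₂⁻¹ ^ (n + 3) * (Real.exp 1 * normV Γ' κ₂ ρ₂ Nw) / (1 - Real.exp 1 * (α' + α + (m₁' + m₁)) * normV Γ' κ₂ ρ₂ Nw / κ₂ ^ 2))) * Te +
        (‖(2 : 𝕜)⁻¹‖ * ∑ a ∈ range (n + 2), ∑ b ∈ range (n + 2),
            (if a + b = n + 1 then (((a + 1) * (b + 1) : ℕ) : ℝ) *
              (4 * (ρ₂⁻¹ ^ (a + 1) * (Real.exp 1 * normV Γ' κ₂ ρ₂ Nw) / (1 - Real.exp 1 * (α' + α + (m₁' + m₁)) * normV Γ' κ₂ ρ₂ Nw / κ₂ ^ 2)) *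
                (ρ₂⁻¹ ^ (b + 1) * (Real.exp 1 * normV Γ' κ₂ ρ₂ Nw) / (1 - Real.exp 1 * (α' + α + (m₁' + m₁)) * normV Γ' κ₂ ρ₂ Nw / κ₂ ^ 2))) else 0)) * T +
        ((((n + 1 + 1) * (n + 1 + 2) : ℕ) : ℝ) / 2 * (s' + s) *
              (ρf⁻¹ ^ (n + 3) * (Real.exp 1 * normV Γ' κf ρf Nw) / (1 - Real.exp 1 * (α' + α + (m₁' + m₁)) * normV Γ' κf ρf Nw / κf ^ 2)) +
            ‖(2 : 𝕜)⁻¹‖ * ∑ a ∈ range (n + 2), ∑ b ∈ range (n + 2),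
              (if a + b = n + 1 then (((a + 1) * (b + 1) : ℕ) : ℝ) *
                (2 * (α' + α) * (ρf⁻¹ ^ (a + 1) * (Real.exp 1 * normV Γ' κf ρf Nw) / (1 - Real.exp 1 * (α' + α + (m₁' + m₁)) * normV Γ' κf ρf Nw / κf ^ 2)) *
                  (ρf⁻¹ ^ (b + 1) * (Real.exp 1 * normV Γ' κf ρf Nw) / (1 - Real.exp 1 * (α' + α + (m₁' + m₁)) * normV Γ' κf ρf Nw / κf ^ 2))) else 0)) * Rf⁻¹ := by
  classical
  -- the two previous actions in the scale-`j+1` variables, and the glued coarse one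
  set V : GrassmannAlgebra 𝕜 Γ := ExteriorAlgebra.map (Matrix.toLin' Tc) 𝒲 with hVdef
  set W' : GrassmannAlgebra 𝕜 Γ' := ExteriorAlgebra.map (Matrix.toLin' Tf) 𝒲' with hW'def
  have hVe : V ∈ evenOdd 𝕜 0 := map_mem_evenOdd_zero 𝕜 (Matrix.toLin' Tc) h𝒲e
  have hV0 : constPart 𝕜 V = 0 := by rw [hVdef, constPart_map, h𝒲0]
  have hW'e : W' ∈ evenPart 𝕜 Γ' := (mem_evenPart_iff).2 (map_mem_evenOdd_zero 𝕜 (Matrix.toLin' Tf) h𝒲'e)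
  have hW'0 : constPart 𝕜 W' = 0 := by rw [hW'def, constPart_map, h𝒲'0]
  have hphi0 : ∀ s, 0 ≤ s → 0 ≤ phi s := fun s hs => zero_le_one.trans (hphi1 s hs)
  -- weighted profile of the glued coarse action (one copy) and of the defect (triangle)
  have hNV' : ∀ m' (j : Fin (2 * m')) (x : Γ'), ∑ Y ∈ univ.filter (fun Y : Fin (2 * m') → Γ' => Y j = x),
      ‖kernel 𝕜 (∑ β, ExteriorAlgebra.map (Fe β) V) (2 * m') Y‖ * diamWeight phi d' (univ.image Y) ≤ NV m' :=
    fun m' j x => sum_pinned_wt_norm_kernel_glue_le e Fe hFe dcw d' hd'blk phi V j (fun x => hNV m' j x) x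
  have hND' : ∀ m' (j : Fin (2 * m')) (x : Γ'), ∑ Y ∈ univ.filter (fun Y : Fin (2 * m') → Γ' => Y j = x),
      ‖kernel 𝕜 (W' - ∑ β, ExteriorAlgebra.map (Fe β) V) (2 * m') Y‖ * diamWeight phi d' (univ.image Y) ≤ NW' m' + NV m' :=
    fun m' j x => sum_pinned_wt_norm_kernel_sub_le _ _ j x (diamWeight phi d') (fun S => hphi0 _ (labelDiam_nonneg _ _))
      (hNW' m' j x) (hNV' m' j x)
  -- the deep defect at scale `j+1` from the TRANSFER through the substitutions, every degree `n + 1`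
  have hEsucc : ∀ (n : ℕ) (p : Fin (n + 1)) (x : Γ'), Pd x →
      ∑ Y ∈ univ.filter (fun Y : Fin (n + 1) → Γ' => Y p = x), ‖kernel 𝕜 (W' - ∑ β, ExteriorAlgebra.map (Fe β) V) (n + 1) Y‖ ≤
        aT ^ n * (aT * Ej (n + 1) + τT * NDj (n + 1)) +
          (2 * aT ^ n * τT * Nj (n + 1) + n * aT ^ n * (5 * τT * Nj (n + 1) + 2 * aT * Nfarj (n + 1))) := by
    intro n p x hx
    have h := sum_norm_kernel_map_sub_glue_map_le_of_defect e₁ e Tc Tf hPT Fe₁ hFe₁ Fe hFe 𝒲' 𝒲 p x (Z x) (Near x) Far₁ (hZT x hx)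
      (NearF x) haT hτT (hNj0 _) (hNfarj0 _) (hEj0 _) (hNDj0 _) hcolT hwinT (hρT x hx) (hrowFT x hx) (hτFT x hx) (hτ₁T x hx) (hτ₂T x hx)
      (hτ₃T x hx) (hτ₄T x hx) (hNj (n + 1) p) (hNfarj (n + 1) p) (hEj x hx (n + 1) p) (hNDj (n + 1) p)
    refine le_trans (le_of_eq (sum_congr rfl fun Y _ => ?_)) h
    rw [hW'def, hVdef, kernel_sub_eq]
  -- … read by the STEP at the even degrees `2 m'`
  have hE : ∀ m' (j : Fin (2 * m')) (x : Γ'), Pd x → ∑ Y ∈ univ.filter (fun Y : Fin (2 * m') → Γ' => Y j = x),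
      ‖kernel 𝕜 (W' - ∑ β, ExteriorAlgebra.map (Fe β) V) (2 * m') Y‖ ≤ Ein m' := by
    intro m'
    rcases Nat.eq_zero_or_pos m' with h0 | hpos
    · subst h0
      intro j
      exact absurd j.2 (by omega)
    · obtain ⟨n, hn⟩ : ∃ n, 2 * m' = n + 1 := ⟨2 * m' - 1, by omega⟩
      have hb := hEin m' hpos n hn
      rw [hn]
      intro j x hx
      exact (hEsucc n j x hx).trans hb
  exact sum_norm_kernel_twoVolume_step_le_linear e C C' Ccop Dn Df Zs hCcop hDf hDn hP Far hG1 hG2 hT0 hT hTe hCt hC't hs0 hs'0 hs hs' hαα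
    hrow hrow' dc hdc hm0 hm0' hm1 hm1' hκf hGBf hκ₂ hGB2 hRf w hdR Fe hFe hVe hV0 hZ Nw hNw0 hNw hρf hθw hρ₂ hθ₂ hκ' hGB' d' hd' hphi1
    hphimono hphisub W' hW'e hW'0 NV (fun m' => NW' m' + NV m') Ein hNV0 (fun m' => add_nonneg (hNW'0 m') (hNV0 m')) hEin0 hNV' hND' Pd hE
    hαw hroww hcolw hρ' hνE hbar hθ₂' hRd hwd n p

end Summit.HubbardSuperconductivity.HubbardSuperconductivity.Theorems.TwoVolumeDefect

end
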